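import Summits.RiemannHypothesis.RiemannHypothesis.Theorems.NymanBeurlingDilateZeroSumExplicit
import Mathlib.Analysis.Normed.Group.Tannery
import Mathlib.Analysis.SpecialFunctions.Pow.Asymptotics
import HarnessLib

/-!
# RiemannHypothesis / Nyman–Beurling — the dilate zero sums tend to `0`; the prime-side consequence
# `(Σ_{m≤n} Λ(m)/m − log n + γ) − (ψ(n) − n)/n → 0` (RH-FREE)

Corollaries of T7 (`NymanBeurlingDilateZeroSumExplicit.lean`) for cell `pub/rh-li`, rung L-P(P2) [rh-li-eng-3 g5]:
* `tendsto_nbDilateZeroSum_zero` — `S(n) = Σ_ρ m_ρ n^{−ρ}/(ρ(1−ρ)) → 0` (zero side: `|n^{−ρ}| = n^{−Re ρ} → 0` termwise, dominated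
  by `Σ m_ρ/|ρ(1−ρ)| < ∞`; Tannery);
* `tendsto_nbDilatePrimeSide_zero` — hence `nbDilatePrimeSide n → 0`, and, peeling off the three explicit `o(1)` terms,
  `tendsto_vonMangoldt_logMean_sub_chebyshev` — **`(Σ_{m≤n} Λ(m)/m − log n + γ) − (ψ(n) − n)/n → 0`** (unconditional; by Abel summation
  this is Landau's `∫_1^x (ψ(t) − t) t⁻² dt → −1 − γ`; obtained here from the zeros with no Tauberian argument);
* `nbKappaPredicted_eq_zeroSide` — theory's prime-side prediction `κ_∞` (L5′) equals the bilinear-BDBLS zero-side expression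
  `[m_1 + Σ_{n≥2}(m_n − m_{n−1}) Re S(n)/(2 + γ − log 4π)]/(1+Q)` literally.
RH-FREE [rh-li-eng-3 g5]; nothing here bears on `d_N → 0` or the truth of RH.
-/

noncomputable section

set_option linter.dupNamespace false

open Filter Set MeasureTheory Topology
open scoped Real

namespace Summit.RiemannHypothesis.RiemannHypothesis.Theorems.NbTheory

open Literature.NumberTheory.LFunctions

/-- **`S(n) → 0`** (RH-FREE; dominated convergence on the zero side). -/
theorem tendsto_nbDilateZeroSum_zero : Tendsto (fun n : ℕ ↦ nbDilateZeroSum n) atTop (𝓝 0) := by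
  have hsum : Summable fun ρ : ZetaZeros.riemannZetaNontrivialZeros ↦
      ‖(riemannZetaZeroOrder (ρ : ℂ) : ℂ) / ((ρ : ℂ) * (1 - ρ))‖ :=
    summable_norm_zeroOrder_div_mul_one_sub
  have h := tendsto_tsum_of_dominated_convergence (𝓕 := atTop) (g := fun _ ↦ (0 : ℂ))
    (f := fun (n : ℕ) (ρ : ZetaZeros.riemannZetaNontrivialZeros) ↦
      (riemannZetaZeroOrder (ρ : ℂ) : ℂ) * (n : ℂ) ^ (-(ρ : ℂ)) / ((ρ : ℂ) * (1 - (ρ : ℂ)))) hsum ?_ ?_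
  · simpa [nbDilateZeroSum] using h
  · intro ρ
    have hre : 0 < (ρ : ℂ).re := ZetaZeros.riemannZetaNontrivialZeros.re_pos ρ.2
    -- `‖term‖ = ‖m/(ρ(1−ρ))‖ · n^{−Re ρ} → 0`
    have hlim : Tendsto (fun n : ℕ ↦ ‖(riemannZetaZeroOrder (ρ : ℂ) : ℂ) / ((ρ : ℂ) * (1 - ρ))‖ *
        (n : ℝ) ^ (-(ρ : ℂ).re)) atTop (𝓝 (‖(riemannZetaZeroOrder (ρ : ℂ) : ℂ) / ((ρ : ℂ) * (1 - ρ))‖ * 0)) :=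
      ((tendsto_rpow_neg_atTop hre).comp tendsto_natCast_atTop_atTop).const_mul _
    rw [mul_zero] at hlim
    refine squeeze_zero_norm' ?_ hlim
    filter_upwards [eventually_ge_atTop 1] with n hn
    have hn0 : 0 < n := hn
    rw [norm_div, norm_mul, Complex.norm_natCast_cpow_of_pos hn0, Complex.neg_re, norm_div]
    exact le_of_eq (by ring)
  · filter_upwards [eventually_ge_atTop 1] with n hn
    intro ρ
    have hn0 : 0 < n := hn
    have hre : 0 < (ρ : ℂ).re := ZetaZeros.riemannZetaNontrivialZeros.re_pos ρ.2
    have hpow : ‖(n : ℂ) ^ (-(ρ : ℂ))‖ ≤ 1 := by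
      rw [Complex.norm_natCast_cpow_of_pos hn0, Complex.neg_re]
      exact Real.rpow_le_one_of_one_le_of_nonpos (by exact_mod_cast hn) (by linarith)
    rw [norm_div, norm_mul, norm_div]
    have h0 : 0 ≤ ‖(riemannZetaZeroOrder (ρ : ℂ) : ℂ)‖ := norm_nonneg _
    have h1 : 0 ≤ ‖(ρ : ℂ) * (1 - ρ)‖ := norm_nonneg _
    calc ‖(riemannZetaZeroOrder (ρ : ℂ) : ℂ)‖ * ‖(n : ℂ) ^ (-(ρ : ℂ))‖ / ‖(ρ : ℂ) * (1 - (ρ : ℂ))‖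
        ≤ ‖(riemannZetaZeroOrder (ρ : ℂ) : ℂ)‖ * 1 / ‖(ρ : ℂ) * (1 - (ρ : ℂ))‖ :=
          div_le_div_of_nonneg_right (mul_le_mul_of_nonneg_left hpow h0) h1
      _ = ‖(riemannZetaZeroOrder (ρ : ℂ) : ℂ)‖ / ‖(ρ : ℂ) * (1 - (ρ : ℂ))‖ := by rw [mul_one]

/-- **`nbDilatePrimeSide n → 0`** (from `S(n) → 0` and T7). -/
theorem tendsto_nbDilatePrimeSide_zero : Tendsto (fun n : ℕ ↦ nbDilatePrimeSide n) atTop (𝓝 0) := by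
  have hC : Tendsto (fun n : ℕ ↦ ((nbDilatePrimeSide n : ℝ) : ℂ)) atTop (𝓝 0) := by
    refine tendsto_nbDilateZeroSum_zero.congr' ?_
    filter_upwards [eventually_ge_atTop 2] with n hn
    exact nbDilateZeroSum_eq_nbDilatePrimeSide hn
  have h := (Complex.continuous_re.tendsto 0).comp hC
  simp only [Complex.zero_re] at h
  exact h.congr fun n ↦ by simp only [Function.comp_apply, Complex.ofReal_re]

/-- The three explicit small terms of `nbDilatePrimeSide` tend to `0`. -/
lemma tendsto_primeSide_smallTerms :
    Tendsto (fun n : ℕ ↦ (1 - Real.log (2 * Real.pi)) / n - 1 / (2 * n) * Real.log (1 - 1 / (n : ℝ) ^ 2)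
      - 1 / 2 * Real.log (((n : ℝ) + 1) / ((n : ℝ) - 1))) atTop (𝓝 0) := by
  have hinv : Tendsto (fun n : ℕ ↦ (1 : ℝ) / n) atTop (𝓝 0) := tendsto_one_div_atTop_nhds_zero_nat
  -- `(1 − log 2π)/n → 0`
  have h1 : Tendsto (fun n : ℕ ↦ (1 - Real.log (2 * Real.pi)) / n) atTop (𝓝 0) := by
    have := hinv.const_mul (1 - Real.log (2 * Real.pi))
    rw [mul_zero] at this
    exact this.congr fun n ↦ by ring
  -- `log(1 − 1/n²) → 0`
  have h2a : Tendsto (fun n : ℕ ↦ Real.log (1 - 1 / (n : ℝ) ^ 2)) atTop (𝓝 0) := by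
    have hsq : Tendsto (fun n : ℕ ↦ 1 - 1 / (n : ℝ) ^ 2) atTop (𝓝 (1 - 0)) := by
      refine tendsto_const_nhds.sub ?_
      have := hinv.pow 2
      simpa [div_pow] using this
    rw [sub_zero] at hsq
    have := (Real.continuousAt_log one_ne_zero).tendsto.comp hsq
    simpa [Function.comp_def, Real.log_one] using this
  have h2 : Tendsto (fun n : ℕ ↦ 1 / (2 * n) * Real.log (1 - 1 / (n : ℝ) ^ 2)) atTop (𝓝 0) := by
    have hb : Tendsto (fun n : ℕ ↦ (1 : ℝ) / (2 * n)) atTop (𝓝 0) := by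
      have := hinv.const_mul (1 / 2)
      simp only [mul_zero] at this
      refine this.congr fun n ↦ ?_
      ring
    simpa using hb.mul h2a
  -- `log((n+1)/(n−1)) → 0`
  have h3a : Tendsto (fun n : ℕ ↦ Real.log (((n : ℝ) + 1) / ((n : ℝ) - 1))) atTop (𝓝 0) := by
    have hq : Tendsto (fun n : ℕ ↦ ((n : ℝ) + 1) / ((n : ℝ) - 1)) atTop (𝓝 1) := by
      have e : ∀ᶠ n : ℕ in atTop, ((n : ℝ) + 1) / ((n : ℝ) - 1) = (1 + 1 / (n : ℝ)) / (1 - 1 / (n : ℝ)) := by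
        filter_upwards [eventually_ge_atTop 2] with n hn
        have hn' : (2 : ℝ) ≤ n := by exact_mod_cast hn
        have hn0 : (n : ℝ) ≠ 0 := by linarith
        field_simp
      have hlim : Tendsto (fun n : ℕ ↦ (1 + 1 / (n : ℝ)) / (1 - 1 / (n : ℝ))) atTop (𝓝 ((1 + 0) / (1 - 0))) :=
        (tendsto_const_nhds.add hinv).div (tendsto_const_nhds.sub hinv) (by norm_num)
      rw [show ((1 : ℝ) + 0) / (1 - 0) = 1 by norm_num] at hlim
      exact hlim.congr' (e.mono fun n hn ↦ hn.symm)
    have := (Real.continuousAt_log one_ne_zero).tendsto.comp hq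
    simpa [Function.comp_def, Real.log_one] using this
  have h3 : Tendsto (fun n : ℕ ↦ 1 / 2 * Real.log (((n : ℝ) + 1) / ((n : ℝ) - 1))) atTop (𝓝 0) := by
    have := h3a.const_mul (1 / 2)
    rw [mul_zero] at this
    exact this
  have h := (h1.sub h2).sub h3
  simpa using h

/-- **RH-FREE PRIME-SIDE COROLLARY (no Tauberian input):**
`(Σ_{m≤n} Λ(m)/m − log n + γ) − (ψ(n) − n)/n → 0` as `n → ∞`
(equivalently, by Abel summation, `∫_1^n (ψ(t) − t) t⁻² dt → −1 − γ`). -/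
theorem tendsto_vonMangoldt_logMean_sub_chebyshev :
    Tendsto (fun n : ℕ ↦ ((∑ m ∈ Finset.range (n + 1), (ArithmeticFunction.vonMangoldt m : ℝ) / m) - Real.log n
        + Real.eulerMascheroniConstant)
      - ((∑ m ∈ Finset.range (n + 1), (ArithmeticFunction.vonMangoldt m : ℝ)) - n) / n) atTop (𝓝 0) := by
  have h := tendsto_nbDilatePrimeSide_zero.sub tendsto_primeSide_smallTerms
  rw [sub_zero] at h
  refine h.congr fun n ↦ ?_
  unfold nbDilatePrimeSide
  ring

/-- **Theory's `κ_∞` prediction is the zero-side bilinear expression literally** (T7 inserted):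
`nbKappaPredicted = [m_1 + Σ_{n≥2} (m_n − m_{n−1}) · Re S(n)/(2 + γ − log 4π)]/(1 + Q)`. -/
theorem nbKappaPredicted_eq_zeroSide :
    nbKappaPredicted = (nbFareyMean 1 + ∑' n : ℕ, (nbFareyMean (n + 2) - nbFareyMean (n + 1)) *
        ((nbDilateZeroSum (n + 2)).re / (2 + Real.eulerMascheroniConstant - Real.log (4 * Real.pi)))) /
      (1 + nbQ) := by
  unfold nbKappaPredicted
  congr 2
  refine tsum_congr fun n ↦ ?_
  rw [nbDilateZeroSum_eq_nbDilatePrimeSide (by omega : 2 ≤ n + 2), Complex.ofReal_re]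

end Summit.RiemannHypothesis.RiemannHypothesis.Theorems.NbTheory

end
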